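import Mathlib
import Literature.Probability.LatticeModels.GKSInequalities
import Summits.CriticalPhenomena.Ising3DConformalLimit.Theorems.PrecisionLaplacianInverseMFerromagnetEntryNonposOfPcov
import Summits.CriticalPhenomena.Ising3DConformalLimit.Theorems.PrecisionLaplacianInverseMFerromagnetRowDegLeTwo
import Summits.CriticalPhenomena.Ising3DConformalLimit.Theorems.PrecisionLaplacianInverseMFerromagnetImNonadjOfLaw2Aux
import Summits.CriticalPhenomena.Ising3DConformalLimit.Theorems.PrecisionLaplacianInverseMFerromagnetImNonadjOfLaw2Aux2
import HarnessLib

/-!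
# Crux `PrecisionLaplacian.InverseMFerromagnet` (stmt-CriticalPhenomena-4798), line `Sketch` —
# stub `stub_imNonadj_of_law2` (C2: `Law₂ ⇒ IM` for non-adjacent pairs of degree ≤ 3)

THEOREM-ONLY file (no definitions).  Let `Σ = (⟨σ_pσ_q⟩)` be the second-moment matrix of the
zero-field pair ferromagnet `μ = gksExpect univ K C` (`K ≥ 0`, `|C i| = 2`) on `Fin n`, and let
`x ≠ y` lie in no common bond, each in at most three bonds.  Assuming `Law₂` (for every pair
ferromagnet and all 3-sets `A, B`: `v_Aᵀ Σ⁻¹ v_B ≤ ⟨σ_Aσ_B⟩`, `v_A(w) = ⟨σ_Aσ_w⟩`) we prove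
`(Σ⁻¹)_xy ≤ 0`.

Proof.  If `deg x ≤ 2` this is C3 (`stub_row_deg_le_two`).  Otherwise write the local fields
`h_x = ∑_{j<3} a_jσ_{v_j}`, `h_y = ∑_{j<3} b_jσ_{w_j}` (`c2_site`; `v_j, w_j ∉ {x,y}`), so that by
the Callen identity (`c2_integrate`) `Σ_xp = ⟨f_xσ_p⟩`, `Σ_qy = ⟨f_yσ_q⟩`, `Σ_xy = ⟨f_xf_y⟩` with
`f_x = tanh h_x`, `f_y = tanh h_y` (conditional independence of `σ_x, σ_y` given the rest
`R = univ ∖ {x,y}`).  Hence the partial covariance `PCov(x,y|R) = Σ_xy − Σ_xR(Σ_RR)⁻¹Σ_Ry` is the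
residual pairing `Res(f_x, f_y)` of `L²(μ)` modulo the span of `{σ_p : p ∈ R}`.  By the Walsh form
`f_x = ∑ α_jσ_{v_j} + κ_xσ_{v_0}σ_{v_1}σ_{v_2}`, `κ_x ≤ 0` (`c2_three`), and `c2_res_lin`,
`c2_res_symm`: `Res(f_x,f_y) = κ_xκ_y Res(σ_B, σ_A)` with `A = {v_j}`, `B = {w_j}` (if the `v_j` or
the `w_j` are not distinct the cubic is a single spin and the residual vanishes, `c2_res_degen`).
Finally `Res(σ_B, σ_A) ≥ 0` (`c2_law2_res`): all its ingredients are expectations of observables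
not involving `σ_x, σ_y`, which agree with those of the star–triangle decimation `ν` (`c2_nu`, a
pair ferromagnet on `Fin n` with `x, y` free), and for `ν` the `R`-block quadratic form is the full
one (`c2_block`), so `Law₂` for `ν` is exactly `Res(σ_B, σ_A) ≥ 0`.  S1
(`stub_entry_nonpos_of_pcov`) turns `PCov(x,y|R) ≥ 0` into `(Σ⁻¹)_xy ≤ 0`.
-/

namespace Summit.CriticalPhenomena.Ising3DConformalLimit.Cruxes.InverseMFerromagnet.PartialCovarianceLadder

open Literature.Probability.LatticeModels Finset Matrix

/-- Registered stub `stub_imNonadj_of_law2` (C2 of line `Sketch`): `Law₂` implies `(Σ⁻¹)_xy ≤ 0`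
for non-adjacent `x ≠ y` of degree `≤ 3`.  With `R = univ ∖ {x,y}`, `E[σ_x | σ_R] = tanh h_x =
(linear) + κ_x σ_{∂x}` (`κ_x ≤ 0`, `c2_three`), `σ_x ⊥ σ_y | σ_R`, so the partial covariance
`PCov(x,y|R)` is the residual pairing `Res(tanh h_x, tanh h_y)` in `L²(μ_R)` modulo the span of the
single spins, `= κ_xκ_y Res(σ_{∂y}, σ_{∂x})` (`c2_res_lin`), and the latter residual is the `Law₂`
bracket of the star–triangle decimation `ν` (`c2_nu`, `c2_law2_res`, `c2_block`), hence `≥ 0`;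
S1 (`stub_entry_nonpos_of_pcov`) concludes.  Degenerate cubics give `Res = 0` (`c2_res_degen`),
degree `≤ 2` is C3 (`stub_row_deg_le_two`). [folklore] -/
theorem stub_imNonadj_of_law2 :
    (∀ (n m : ℕ) (K : Fin m → ℝ) (C : Fin m → Finset (Fin n)), (∀ i, 0 ≤ K i) → (∀ i, (C i).card = 2) →
      ∀ (A B : Finset (Fin n)), A.card = 3 → B.card = 3 →
        dotProduct (fun w => gksExpect Finset.univ K C (fun ω => spinProduct A ω * spinAt w ω))
          (((Matrix.of fun p q : Fin n =>
              gksExpect Finset.univ K C (fun ω => spinAt p ω * spinAt q ω))⁻¹).mulVec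
            (fun w => gksExpect Finset.univ K C (fun ω => spinProduct B ω * spinAt w ω)))
        ≤ gksExpect Finset.univ K C (fun ω => spinProduct A ω * spinProduct B ω)) →
    ∀ (n m : ℕ) (K : Fin m → ℝ) (C : Fin m → Finset (Fin n)), (∀ i, 0 ≤ K i) → (∀ i, (C i).card = 2) →
      ∀ x y : Fin n, x ≠ y → (∀ i, ¬ (x ∈ C i ∧ y ∈ C i)) →
        (Finset.univ.filter (fun i => x ∈ C i)).card ≤ 3 → (Finset.univ.filter (fun i => y ∈ C i)).card ≤ 3 →
        (Matrix.of fun p q : Fin n => gksExpect Finset.univ K C (fun ω => spinAt p ω * spinAt q ω))⁻¹ x y ≤ 0 := by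
  intro hlaw n m K C hK hC x y hxy hnadj hdx hdy
  -- sites of degree `≤ 2`: C3
  by_cases hdx2 : (Finset.univ.filter fun i => x ∈ C i).card ≤ 2
  · exact stub_row_deg_le_two n m K C hK hC x y hxy hdx2
  -- a site `d ∉ {x, y}` (a neighbour of `x`)
  obtain ⟨d, hdx', hdy'⟩ : ∃ d : Fin n, d ≠ x ∧ d ≠ y := by
    obtain ⟨i, hi⟩ : (Finset.univ.filter fun i => x ∈ C i).Nonempty := by
      rw [← Finset.card_pos]; omega
    have hxi : x ∈ C i := (Finset.mem_filter.1 hi).2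
    obtain ⟨p, hp, hpx⟩ := Finset.exists_mem_ne (s := C i) (by rw [hC i]; norm_num) x
    exact ⟨p, hpx, fun h => hnadj i ⟨hxi, h ▸ hp⟩⟩
  have hnadj' : ∀ i, ¬ (y ∈ C i ∧ x ∈ C i) := fun i h => hnadj i ⟨h.2, h.1⟩
  -- local fields `h_x = ∑ a_j σ_{v_j}`, `h_y = ∑ b_j σ_{w_j}` and their Walsh / star–triangle forms
  obtain ⟨a, v, ha, hv, hHx⟩ := c2_site K C hK hC x y hnadj hdx d ⟨hdx', hdy'⟩
  obtain ⟨b, w, hb, hw, hHy⟩ := c2_site K C hK hC y x hnadj' hdy d ⟨hdy', hdx'⟩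
  obtain ⟨α, κx, cx, Jx, hκx, hJx, h3x⟩ := c2_three a ha
  obtain ⟨β, κy, cy, Jy, hκy, hJy, h3y⟩ := c2_three b hb
  obtain ⟨hx, hhx⟩ : ∃ hx : SpinConfig (Fin n) → ℝ, ∀ ω, hx ω = ∑ j, a j * spinAt (v j) ω :=
    ⟨_, fun _ => rfl⟩
  obtain ⟨hy, hhy⟩ : ∃ hy : SpinConfig (Fin n) → ℝ, ∀ ω, hy ω = ∑ j, b j * spinAt (w j) ω :=
    ⟨_, fun _ => rfl⟩
  have hH1 : ∀ ω, gksHamiltonian Finset.univ K C ω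
      = gksHamiltonian Finset.univ (fun i => if x ∈ C i then 0 else K i) C ω + spinAt x ω * hx ω :=
    fun ω => by rw [hhx]; exact hHx K (fun _ _ => rfl) ω
  have hH2 : ∀ ω, gksHamiltonian Finset.univ (fun i => if x ∈ C i then 0 else K i) C ω
      = gksHamiltonian Finset.univ
          (fun i => if y ∈ C i then 0 else if x ∈ C i then 0 else K i) C ω + spinAt y ω * hy ω :=
    fun ω => by rw [hhy]; exact hHy _ (fun i hi => if_neg fun h => hnadj i ⟨h, hi⟩) ω
  have hH2' : ∀ ω, gksHamiltonian Finset.univ K C ω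
      = gksHamiltonian Finset.univ (fun i => if y ∈ C i then 0 else K i) C ω + spinAt y ω * hy ω :=
    fun ω => by rw [hhy]; exact hHy K (fun _ _ => rfl) ω
  have hvx : ∀ j, v j ≠ x := fun j => (hv j).1
  have hvy : ∀ j, v j ≠ y := fun j => (hv j).2
  have hwy : ∀ j, w j ≠ y := fun j => (hw j).1
  have hwx : ∀ j, w j ≠ x := fun j => (hw j).2
  have hx_x : ∀ ω, hx (ω * Pi.mulSingle x (-1)) = hx ω := fun ω => by
    rw [hhx, hhx]; exact Finset.sum_congr rfl fun j _ => by rw [pcm2im_spinAt_flip_ne (hvx j)]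
  have hx_y : ∀ ω, hx (ω * Pi.mulSingle y (-1)) = hx ω := fun ω => by
    rw [hhx, hhx]; exact Finset.sum_congr rfl fun j _ => by rw [pcm2im_spinAt_flip_ne (hvy j)]
  have hy_y : ∀ ω, hy (ω * Pi.mulSingle y (-1)) = hy ω := fun ω => by
    rw [hhy, hhy]; exact Finset.sum_congr rfl fun j _ => by rw [pcm2im_spinAt_flip_ne (hwy j)]
  -- the conditional expectations `E[σ_x F] = E[tanh(h_x) F]`, `E[σ_y F] = E[tanh(h_y) F]`
  have hEx : ∀ F : SpinConfig (Fin n) → ℝ, (∀ ω, F (ω * Pi.mulSingle x (-1)) = F ω) →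
      gksExpect Finset.univ K C (fun ω => spinAt x ω * F ω)
        = gksExpect Finset.univ K C (fun ω => Real.tanh (hx ω) * F ω) :=
    fun F hF => (c2_integrate Finset.univ K _ C x hx hH1 (fun i _ hi => if_pos hi) hx_x F hF).1
  have hEy : ∀ F : SpinConfig (Fin n) → ℝ, (∀ ω, F (ω * Pi.mulSingle y (-1)) = F ω) →
      gksExpect Finset.univ K C (fun ω => spinAt y ω * F ω)
        = gksExpect Finset.univ K C (fun ω => Real.tanh (hy ω) * F ω) :=
    fun F hF => (c2_integrate Finset.univ K _ C y hy hH2' (fun i _ hi => if_pos hi) hy_y F hF).1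
  -- the normalised weight `P` of `μ`
  obtain ⟨P, hPdef⟩ : ∃ P : SpinConfig (Fin n) → ℝ,
      ∀ ω, P ω = gksWeight Finset.univ K C ω / gksSum Finset.univ K C (fun _ => 1) :=
    ⟨_, fun _ => rfl⟩
  have hP : ∀ f : SpinConfig (Fin n) → ℝ, gksExpect Finset.univ K C f = ∑ ω, P ω * f ω := fun f => by
    simp only [gksExpect, gksSum, Finset.sum_div, hPdef]
    exact Finset.sum_congr rfl fun ω _ => by ring
  -- the matrix `G = Σ`, the set `S = univ ∖ {x, y}` and the Schur step S1
  obtain ⟨G, hG⟩ : ∃ G : Matrix (Fin n) (Fin n) ℝ, G = Matrix.of fun p q : Fin n =>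
      gksExpect Finset.univ K C (fun ω => spinAt p ω * spinAt q ω) := ⟨_, rfl⟩
  have hGe : ∀ p q, G p q = gksExpect Finset.univ K C (fun ω => spinAt p ω * spinAt q ω) :=
    fun p q => by rw [hG]; rfl
  rw [← hG]
  obtain ⟨S, hS⟩ : ∃ S : Finset (Fin n), S = (Finset.univ.erase x).erase y := ⟨_, rfl⟩
  have hS1 : ∀ p : ↥S, p.1 ≠ x ∧ p.1 ≠ y := fun p => by
    have h : p.1 ∈ (Finset.univ.erase x).erase y := by rw [← hS]; exact p.2
    rw [Finset.mem_erase, Finset.mem_erase] at h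
    exact ⟨h.2.1, h.1⟩
  have hS2 : ∀ p, p ∉ S → p = x ∨ p = y := fun p hp => by
    rw [hS] at hp
    simp only [Finset.mem_erase, Finset.mem_univ, and_true, not_and, not_not] at hp
    tauto
  refine stub_entry_nonpos_of_pcov n m K C hK hC G hG x y S hxy hS ?_
  obtain ⟨M, hMd⟩ : ∃ M : Matrix ↥S ↥S ℝ,
      M = G.submatrix (Subtype.val : ↥S → Fin n) (Subtype.val : ↥S → Fin n) := ⟨_, rfl⟩
  rw [← hMd]
  obtain ⟨χ, hχ⟩ : ∃ χ : ↥S → SpinConfig (Fin n) → ℝ, ∀ p ω, χ p ω = spinAt p.1 ω :=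
    ⟨_, fun _ _ => rfl⟩
  have hM : ∀ p q, M p q = ∑ ω, P ω * (χ p ω * χ q ω) := fun p q => by
    rw [hMd, Matrix.submatrix_apply, hGe, hP]
    simp only [hχ]
  have hdet : IsUnit M.det := by
    have hpd : M.PosDef := by
      rw [hMd, hG]
      exact (schur_posDef n m K C).submatrix Subtype.val_injective
    exact (Matrix.isUnit_iff_isUnit_det M).mp hpd.isUnit
  -- `PCov(x,y|S) = Res(f_x, f_y)` with `f_x = tanh h_x`, `f_y = tanh h_y`
  obtain ⟨fx, hfx⟩ : ∃ fx : SpinConfig (Fin n) → ℝ, ∀ ω, fx ω = Real.tanh (hx ω) :=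
    ⟨_, fun _ => rfl⟩
  obtain ⟨fy, hfy⟩ : ∃ fy : SpinConfig (Fin n) → ℝ, ∀ ω, fy ω = Real.tanh (hy ω) :=
    ⟨_, fun _ => rfl⟩
  have hGxy : G x y = ∑ ω, P ω * (fx ω * fy ω) := by
    rw [hGe, hEx _ (fun ω => pcm2im_spinAt_flip_ne hxy.symm ω)]
    have h1 : (fun ω => Real.tanh (hx ω) * spinAt y ω) = fun ω => spinAt y ω * Real.tanh (hx ω) :=
      funext fun ω => mul_comm _ _
    rw [h1, hEy _ (fun ω => by rw [hx_y]), hP]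
    exact Finset.sum_congr rfl fun ω _ => by rw [hfx, hfy]; ring
  have hGxp : ∀ p : ↥S, G x p.1 = ∑ ω, P ω * (fx ω * χ p ω) := fun p => by
    rw [hGe, hEx _ (fun ω => pcm2im_spinAt_flip_ne (hS1 p).1 ω), hP]
    exact Finset.sum_congr rfl fun ω _ => by rw [hfx, hχ]
  have hGqy : ∀ q : ↥S, G q.1 y = ∑ ω, P ω * (fy ω * χ q ω) := fun q => by
    rw [hGe]
    have h1 : (fun ω => spinAt q.1 ω * spinAt y ω) = fun ω => spinAt y ω * spinAt q.1 ω :=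
      funext fun ω => mul_comm _ _
    rw [h1, hEy _ (fun ω => pcm2im_spinAt_flip_ne (hS1 q).2 ω), hP]
    exact Finset.sum_congr rfl fun ω _ => by rw [hfy, hχ]
  rw [hGxy]
  simp only [hGxp, hGqy]
  -- the Walsh forms of `f_x`, `f_y`
  have hvS : ∀ j, v j ∈ S := fun j => by rw [hS]; simp [hvx j, hvy j]
  have hwS : ∀ j, w j ∈ S := fun j => by rw [hS]; simp [hwx j, hwy j]
  obtain ⟨ιv, hιv⟩ : ∃ ι : Fin 3 → ↥S, ∀ j, (ι j).1 = v j := ⟨fun j => ⟨v j, hvS j⟩, fun _ => rfl⟩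
  obtain ⟨ιw, hιw⟩ : ∃ ι : Fin 3 → ↥S, ∀ j, (ι j).1 = w j := ⟨fun j => ⟨w j, hwS j⟩, fun _ => rfl⟩
  have tx : ∀ ω, fx ω = ∑ j, α j * χ (ιv j) ω
      + κx * (spinAt (v 0) ω * spinAt (v 1) ω * spinAt (v 2) ω) := fun ω => by
    rw [hfx, hhx]
    simp only [hχ, hιv]
    exact (h3x (fun j => spinAt (v j) ω) (fun j => spinAt_eq_one_or_eq_neg_one _ _)).1
  have ty : ∀ ω, fy ω = ∑ j, β j * χ (ιw j) ω
      + κy * (spinAt (w 0) ω * spinAt (w 1) ω * spinAt (w 2) ω) := fun ω => by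
    rw [hfy, hhy]
    simp only [hχ, hιw]
    exact (h3y (fun j => spinAt (w j) ω) (fun j => spinAt_eq_one_or_eq_neg_one _ _)).1
  by_cases hvd : v 0 ≠ v 1 ∧ v 0 ≠ v 2 ∧ v 1 ≠ v 2
  · obtain ⟨A, hA⟩ : ∃ A : Finset (Fin n), A = {v 0, v 1, v 2} := ⟨_, rfl⟩
    have hA3 : A.card = 3 := by
      rw [hA, Finset.card_eq_three]
      exact ⟨_, _, _, hvd.1, hvd.2.1, hvd.2.2, rfl⟩
    have hxA : x ∉ A := hA ▸ c2_notMem_three v x hvx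
    have hyA : y ∉ A := hA ▸ c2_notMem_three v y hvy
    have tx' : ∀ ω, fx ω = ∑ j, α j * χ (ιv j) ω + κx * spinProduct A ω := fun ω => by
      rw [tx, hA, c2_spinProduct_three hvd.1 hvd.2.1 hvd.2.2]
    rw [c2_res_lin P χ M hM hdet fx (spinProduct A) fy ιv α κx tx',
      c2_res_symm P χ M hM (spinProduct A) fy]
    by_cases hwd : w 0 ≠ w 1 ∧ w 0 ≠ w 2 ∧ w 1 ≠ w 2
    · obtain ⟨B, hB⟩ : ∃ B : Finset (Fin n), B = {w 0, w 1, w 2} := ⟨_, rfl⟩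
      have hB3 : B.card = 3 := by
        rw [hB, Finset.card_eq_three]
        exact ⟨_, _, _, hwd.1, hwd.2.1, hwd.2.2, rfl⟩
      have hxB : x ∉ B := hB ▸ c2_notMem_three w x hwx
      have hyB : y ∉ B := hB ▸ c2_notMem_three w y hwy
      have ty' : ∀ ω, fy ω = ∑ j, β j * χ (ιw j) ω + κy * spinProduct B ω := fun ω => by
        rw [ty, hB, c2_spinProduct_three hwd.1 hwd.2.1 hwd.2.2]
      rw [c2_res_lin P χ M hM hdet fy (spinProduct B) (spinProduct A) ιw β κy ty', ← mul_assoc]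
      refine mul_nonneg (mul_nonneg_of_nonpos_of_nonpos hκx hκy) ?_
      -- the decimated system `ν` and `Law₂`
      have hKxy0 : ∀ i, 0 ≤ (if y ∈ C i then 0 else if x ∈ C i then 0 else K i) := fun i => by
        split_ifs <;> first | exact le_rfl | exact hK i
      have hKxy' : ∀ i, x ∈ C i → (if y ∈ C i then 0 else if x ∈ C i then 0 else K i) = 0 :=
        fun i hi => by rw [if_pos hi, ite_self]
      obtain ⟨m', K', C', hK', hC', hX, hY, hdec⟩ := c2_nu K _ _ C hKxy0 hC x y hx hy
        cx cy Jx Jy hJx hJy v w hv hw hvd hwd hH1 hH2 (fun i hi => if_pos hi)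
        (fun i hi => if_pos hi) hKxy' hx_x hx_y hy_y
        (fun ω => by rw [hhx]; exact (h3x (fun j => spinAt (v j) ω)
          (fun j => spinAt_eq_one_or_eq_neg_one _ _)).2)
        (fun ω => by rw [hhy]; exact (h3y (fun j => spinAt (w j) ω)
          (fun j => spinAt_eq_one_or_eq_neg_one _ _)).2)
      have key := c2_law2_res hlaw K C K' C' hK' hC' x y hX hY hdec S hS2 hS1 A B hA3 hB3
        hxA hyA hxB hyB
      rw [← hG, ← hMd] at key
      simpa only [hP, hχ] using key
    · obtain ⟨j₀, hj₀⟩ := c2_cube_degen w hwd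
      have ty' : ∀ ω, fy ω = ∑ j, β j * χ (ιw j) ω + κy * χ (ιw j₀) ω := fun ω => by
        rw [ty, hj₀, hχ, hιw]
      rw [c2_res_degen P χ M hM hdet fy (spinProduct A) ιw β κy j₀ ty', mul_zero]
  · obtain ⟨j₀, hj₀⟩ := c2_cube_degen v hvd
    have tx' : ∀ ω, fx ω = ∑ j, α j * χ (ιv j) ω + κx * χ (ιv j₀) ω := fun ω => by
      rw [tx, hj₀, hχ, hιv]
    rw [c2_res_degen P χ M hM hdet fx fy ιv α κx j₀ tx']

end Summit.CriticalPhenomena.Ising3DConformalLimit.Cruxes.InverseMFerromagnet.PartialCovarianceLadder
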